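import Summits.QuantumFields.YangMills.Theorems.BalabanUVNodesN04AtRecord
import Literature.MathematicalPhysics.QuantumFieldTheory.Balaban1983to89.B15LeafKnitTower9

/-!
# BalabanUVNodes ∕ N12 — the K3 stub `S_N12 Rec := AtRecord Rec Dag.B15_main` of `BalabanUVNodesClustersCore` AT NODE 00's C-BOUND RECORDS:
# `Iff.rfl` reading, antitone, the refinement-generic CONDITIONAL closers for the W-pinning refinement (the [IV] bundle of a run is RESIDUAL at ₅C ∕ ₇C ∕ ₈C),
# the KERNEL CENSUS that the leaf form of the slot is FALSE over each landed record predicate of record (₅C, ₇C, ₈C — unconditionally), the vacuity guards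
# (in-edges `b5`, `b7` hold), and the closer AT THE REPRESENTED TOWER OF RECORD (Stage ₉) modulo [Balaban1989LargeFieldI]'s three printed estimates
# (Track A, DAG node N12 = [B15, Balaban1989LargeFieldI] CMP 122:175, basic step of 𝐑 (0.1)–(0.6), Prop 1 p.194, (1.80), (1.89), 𝐑′ (1.99)–(1.100); count-neutral)

HONEST FRAMING.  Count-neutral kernel BOOKKEEPING over landed theorems, by name; nothing of Bałaban's is asserted or re-derived.  N12 is NOT discharged
and CANNOT be over the record predicates landed so far (§3: the [IV] bundle `W` the `rBasicStep` leaf reads is RESIDUAL at Stages 5–8); its closer of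
record (§4) is CONDITIONAL on NODE 00's W-pinning refinement (Stage ₉) and on EXACTLY the printed estimates Proposition 1 (1.78), (1.80), (1.89) (+ (1.102)
or the 𝐑′ = 𝐑-step identification) at the objects of record.  One finite four-torus programme at fixed `ε`; nothing continuum ∕ ℝ⁴ ∕ OS ∕ mass-gap ∕ Clay.
0 `def`, 0 `sorry`, standard axioms.

WHAT THIS MODULE IS.  The cluster file `BalabanUVNodesClustersCore` (p416552) types the K3 stub `YMDAG.UVSplit.S_N12 Rec := AtRecord Rec Dag.B15_main` over a
record-predicate PARAMETER `Rec : RecordPred N`; by the route's ONE WRITER's word (W2) (pub-ymgap dag-lead DEDUP №15, 2026-08-26) the per-node «AT-RECORD»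
module IS the node's CLOSER OF RECORD for `S_N0x`.  Seat `pub-ymgap-dag-n12-a` (g2; -a = KNIT-BY-NAME, HUMAN RULING D-0062), model = `BalabanUVNodesN04AtRecord`
(seat dag-n04-a).  Contents:
* §1 `s_N12_iff` (the stub unfolded: «at every record run, `b5 → b7 → b8 → b10 → b11 → rBasicStep`»), `s_N12_antitone`, `s_N12_of_leaf` (from the [IV] leaf
  `rBasicStep` at every record run — how every closer below concludes; no ex-falso through an in-edge), `s_N12_of_pinned₅C` (for `Rec` refining ₅C:
  `S_N12` from the slot IN PINNED FORM «the B15 leaf for the parameters that bind the world» — seat's `B15LeafKnitRecord7.forall_pinned_b15Leaf_iff_rBasicStep₇C`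
  shape at ₅C).
* §2 VACUITY GUARDS (A5): at every run of every ₅C ∕ ₇C ∕ ₈C record the in-edge leaves `b5`, `b7` are INHABITED (`BalabanUVNodesN04AtRecord.leaf_b5∕b7_of_…`
  BY NAME); the remaining antecedents `b8`, `b10`, `b11` read residual carriers (`X`'s B8 data, B10 at the C-binding, `Z`) and are not asserted.
* §3 KERNEL CENSUS (A2, F-n24T-1 ∕ (R-C1) class, for the [IV] slot): the W-swap at Stage 8 (`isRecordOfRecord₈C_updW`: re-binding a record world to the
  bundle-swapped parameters is again a ₈C record over the SAME datum) and at Stage 5 (`isRecordOfRecord₅C_updW`); hence — with a four-torus family and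
  NODE 00's inhabited ₈C (`Record8Inhabited.exists_isRecordOfRecord₈C`, the zero-chart typing witness) — **`not_atRecord_rBasicStep₈C ∕ ₇C ∕ ₅C`**: the LEAF FORM
  `AtRecord Rec (·.rBasicStep)` of N12's slot is FALSE at `Rec :=` each landed record predicate of record, UNCONDITIONALLY (kernel facts; seat's module 7
  `B15LeafKnitRecord7.not_b15Leaf_emptyClaim`).  Said plainly: no `S_N12`-closer «from the leaf» exists over ₅C ∕ ₇C ∕ ₈C; `S_N12 Rec` itself (with its five
  antecedents) is not refuted here — at the junk world the residual antecedents `b8 ∕ b10 ∕ b11` need not hold.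
* §4 THE CONDITIONAL CLOSERS OF RECORD (the (W2) «refinement-generic» pair in the only form N12 admits): **`s_N12_of_refines₅C_of_leaf`** — for EVERY `Rec`
  whose worlds are bound, family by family, to `upOfRecord₅C (toS5 θ)` for SOME admissible parameter of a refinement `Θ F → Stage5Params F N` at whose
  `res.W` the B15 leaf holds: `S_N12 Rec` (seat's `B15LeafKnitRecord7.b15_main_of_refines₅C_of_leaf`); and **`s_N12_of_refines₅C_WOfTower9`** — the same with
  `res.W P` PINNED to the [IV] bundle read at the REPRESENTED TOWER OF RECORD (NODE 00 Stage ₉, seat node00-def-T's `RepTowerOfRecord` p417991; seat's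
  `B15LeafKnitTower9.b15_main_of_refines₅C_WOfTower9` p418770): `S_N12 Rec` from the pre-𝐑 terms of the tower measurable ∕ ≥ 0 ∕ bounded ∕ of POSITIVE MASS
  (chair R446 (A) «(R-C2) MASS reading») and EXACTLY Proposition 1 (1.78), (1.80) on the ℍ-domains, (1.89), (1.102) at the objects of record — THE closer
  the rev-1 `closes` over the W-pinned Stage-₉ record consumes by ONE application to NODE 00's refinement lemma.
* §5 K3 bookkeeping: given the other K3 stubs, `RenormalisationBeta Rec` follows from N12's conditional closer's hypotheses (one line through
  `BalabanUVNodesN04AtRecord.renormalisationBeta_of_rest_of_refines₅C`).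
Sources: T. Bałaban, CMP **122** (1989) 175–202 [Balaban1989LargeFieldI] (0.2)–(0.6) p.176, Prop. 1 (1.78) p.194, (1.80) p.195, (1.89) p.198, (1.99)–(1.102)
pp.200–201; the in-edges [Balaban1984PropagatorsI] Props. 1.1–1.2, [Balaban1985Averaging] Props. 1–10; the record dictionaries of [Balaban1987RG1] (0.17)–(0.22)
and [Balaban1989LargeFieldII] Thm 1 p.355; the represented tower [Balaban1988Convergent] (2.18) p.257, (3.24)–(3.25) p.270.
-/

noncomputable section

open scoped BigOperators
open MeasureTheory

namespace Summit.QuantumFields.YangMills.BalabanUVNodes.N12AtRecord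

open Literature.MathematicalPhysics.QuantumFieldTheory.Balaban1983to89
open Literature.MathematicalPhysics.QuantumFieldTheory.Balaban1983to89.T4Continuum (T4Family FiniteEpsData)
open Literature.MathematicalPhysics.QuantumFieldTheory.Balaban1983to89.DagBinding (WorldP leavesP PrintedCarriers15 B15Leaf)
open Literature.MathematicalPhysics.QuantumFieldTheory.Balaban1983to89.Node00 (Stage5Params Stage7Params Stage8Params upOfRecord₅C datumOfRecord₅
  IsRecordOfRecord₅C IsRecordOfRecord₇C IsRecordOfRecord₈C isRecordOfRecord₅C_of_isRecordOfRecord₇C isRecordOfRecord₇C_of_isRecordOfRecord₈C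
  isRecordOfRecord₅C_of_isRecordOfRecord₈C Stage7Numerics TowerNumerics StepWeightsOfRecord PpSelOfRecord repTOfRecord9 trhoOfRecord9 fibOfSeq rterm)
open Literature.MathematicalPhysics.QuantumFieldTheory.Balaban1983to89.B15LeafKnitRecord7 (not_b15Leaf_emptyClaim datumOfRecord₅_updW
  isRecordOfRecord₇C_updW rBasicStep_upOfRecord₅C_iff b15_main_of_refines₅C_of_leaf)
open Literature.MathematicalPhysics.QuantumFieldTheory.Balaban1983to89.B15LeafKnitRepr (WOfRepr)
open Literature.MathematicalPhysics.QuantumFieldTheory.Balaban1983to89.B15LeafKnitTower9 (b15_main_of_refines₅C_WOfTower9)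
open Summit.QuantumFields.YangMills.BalabanUVNodes.N04AtRecord (leaf_b5_of_isRecordOfRecord₅C leaf_b7_of_isRecordOfRecord₅C
  leaf_b5_of_isRecordOfRecord₇C leaf_b7_of_isRecordOfRecord₇C leaf_b5_of_isRecordOfRecord₈C leaf_b7_of_isRecordOfRecord₈C
  renormalisationBeta_of_rest_of_refines₅C)
open YMDAG.UVSplit (Datum RecordPred AtRecord S_N04 S_N05 S_N07 S_N08 S_N12 S_N25 S_BetaSide RenormalisationBeta)

variable {N : ℕ} [NeZero N]

/-! ## §1 The stub unfolded; antitone in `Rec`; from the leaf; from the slot in pinned form -/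

/-- **What `S_N12 Rec` says** (`Iff.rfl`): at every run of every binding world of every record pair, the in-edge leaves `b5` ([B5]), `b7` ([B7]), `b8` ([B8]),
`b10` ([B10]), `b11` ([B11]) imply the [IV] leaf `rBasicStep` (= `DagBinding.B15Leaf W` at the N∕C-bindings: (0.4) ∧ (0.6) ∧ Prop 1 (1.78) ∧ (1.80) ∧ (1.89) ∧
(1.102) over the run's [IV] bundle `W`). [cite: Balaban1989LargeFieldI, Prop. 1 p.194, (0.4)–(0.6) p.176, (1.80) p.195, (1.89) p.198, (1.102) p.201 (the node's content; bookkeeping)] -/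
theorem s_N12_iff (Rec : RecordPred N) :
    S_N12 Rec ↔ ∀ (F : T4Family) (D : Datum F N) (w : WorldP), Rec F D w → ∀ P : B12.RunParams,
      (leavesP w P).b5 → (leavesP w P).b7 → (leavesP w P).b8 → (leavesP w P).b10 → (leavesP w P).b11 → (leavesP w P).rBasicStep :=
  Iff.rfl

/-- **`S_N12` is ANTITONE in the record predicate**: proved at `Rec`, it holds at every `Rec'` refining `Rec`. [cite: Balaban1989LargeFieldI, Prop. 1 p.194 (bookkeeping)] -/
theorem s_N12_antitone {Rec Rec' : RecordPred N}
    (hle : ∀ (F : T4Family) (D : Datum F N) (w : WorldP), Rec' F D w → Rec F D w) (h : S_N12 Rec) : S_N12 Rec' :=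
  fun F D w hR P => h F D w (hle F D w hR) P

/-- `S_N12 Rec` from N12's OWN LEAF at the record (the five in-edges are not consumed — how every closer below concludes; no ex-falso route).
[cite: Balaban1989LargeFieldI, Prop. 1 p.194 (bookkeeping)] -/
theorem s_N12_of_leaf (Rec : RecordPred N)
    (h : ∀ (F : T4Family) (D : Datum F N) (w : WorldP), Rec F D w → ∀ P : B12.RunParams, (leavesP w P).rBasicStep) : S_N12 Rec :=
  fun F D w hR P _ _ _ _ _ => h F D w hR P

/-- **`S_N12 Rec` from the slot IN PINNED FORM at records refining ₅C**: if for every `Rec`-pair the B15 leaf holds for the [IV] bundle of the admissible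
Stage-5 parameters THAT BIND THE WORLD (`∀ θ, θ.Admissible → D = datumOfRecord₅ θ → (∀ P, w.up P = upOfRecord₅C θ P) → ∀ P, B15Leaf (θ.res.W P)` — the
satisfiable form of the slot, = the world's own leaf: seat's module 7), then `S_N12 Rec`. [cite: Balaban1989LargeFieldI, Prop. 1 p.194 (bookkeeping)] -/
theorem s_N12_of_pinned₅C (Rec : RecordPred N)
    (hR : ∀ (F : T4Family) (D : Datum F N) (w : WorldP), Rec F D w → IsRecordOfRecord₅C F N D w)
    (hW : ∀ (F : T4Family) (D : Datum F N) (w : WorldP), Rec F D w → ∀ θ : Stage5Params F N, θ.Admissible → D = datumOfRecord₅ F N θ →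
      (∀ P, w.up P = upOfRecord₅C F N θ P) → ∀ P : B12.RunParams, B15Leaf (θ.res.W P)) : S_N12 Rec := by
  refine s_N12_of_leaf Rec (fun F D w hRec P => ?_)
  obtain ⟨θ, hθ, hD, -, -, -, hup⟩ := hR F D w hRec
  show (w.up P).rBasicStep
  rw [hup P]
  exact (rBasicStep_upOfRecord₅C_iff θ P).2 (hW F D w hRec θ hθ hD hup P)

/-! ## §2 VACUITY GUARDS at the C-bound records: the in-edges `b5`, `b7` are INHABITED (₅C, ₇C, ₈C) -/

section Guards

variable {F : T4Family} {D : FiniteEpsData F (YMDAG.UVSplit.SU N)} {w : WorldP}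

/-- **Guards, ₅C**: at every run of a Stage-5 (C-bound) record the in-edge leaves `b5` ([B5]) and `b7` ([B7]) HOLD (NODE 00's N01 ∕ N02 ∕ N04 of record, via
`BalabanUVNodesN04AtRecord` BY NAME). [cite: Balaban1984PropagatorsI, Props. 1.1–1.2 pp.33–36; Balaban1985Averaging, Props. 1–10 pp.26–50 (kernel versions at the objects of record)] -/
theorem guards_b5_b7_of_isRecordOfRecord₅C (h : IsRecordOfRecord₅C F N D w) (P : B12.RunParams) :
    (leavesP w P).b5 ∧ (leavesP w P).b7 :=
  ⟨leaf_b5_of_isRecordOfRecord₅C h P, leaf_b7_of_isRecordOfRecord₅C h P⟩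

/-- **Guards, ₇C**. [cite: Balaban1984PropagatorsI, Props. 1.1–1.2 pp.33–36; Balaban1985Averaging, Props. 1–10 pp.26–50 (bookkeeping)] -/
theorem guards_b5_b7_of_isRecordOfRecord₇C (h : IsRecordOfRecord₇C F N D w) (P : B12.RunParams) :
    (leavesP w P).b5 ∧ (leavesP w P).b7 :=
  ⟨leaf_b5_of_isRecordOfRecord₇C h P, leaf_b7_of_isRecordOfRecord₇C h P⟩

/-- **Guards, ₈C**. [cite: Balaban1984PropagatorsI, Props. 1.1–1.2 pp.33–36; Balaban1985Averaging, Props. 1–10 pp.26–50 (bookkeeping)] -/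
theorem guards_b5_b7_of_isRecordOfRecord₈C (h : IsRecordOfRecord₈C F N D w) (P : B12.RunParams) :
    (leavesP w P).b5 ∧ (leavesP w P).b7 :=
  ⟨leaf_b5_of_isRecordOfRecord₈C h P, leaf_b7_of_isRecordOfRecord₈C h P⟩

end Guards

/-! ## §3 KERNEL CENSUS: the leaf form of the slot is FALSE over the landed record predicates (₅C, ₇C, ₈C) -/

section Census

variable {F : T4Family} {D : FiniteEpsData F (YMDAG.UVSplit.SU N)} {w : WorldP}

/-- Swapping the residual [IV] bundle commutes with Stage 8's Stage-5 view (`rfl`: `toStage7W` ∕ `residualOfStage7` overwrite β ∕ actions ∕ χ ∕ dom ∕ E ∕ R,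
never `W`). [cite: Balaban1987RG1, (0.22)–(0.24) p.256 (bookkeeping: the Stage-8 dictionary)] -/
theorem toStage5_updW₈ (θ : Stage8Params F N) (W' : B12.RunParams → PrintedCarriers15) :
    ({ θ with res := { θ.res with W := W' } } : Stage8Params F N).toStage5 F N =
      { θ.toStage5 F N with res := { (θ.toStage5 F N).res with W := W' } } := rfl

/-- Stage-8 admissibility does not read the bundle. [cite: Balaban1987RG1, (0.17)–(0.22) pp.255–256 (bookkeeping: the parameter dictionary)] -/
theorem admissible₈_updW {θ : Stage8Params F N} (hθ : θ.Admissible) (W' : B12.RunParams → PrintedCarriers15) :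
    ({ θ with res := { θ.res with W := W' } } : Stage8Params F N).Admissible :=
  hθ

/-- **Re-binding a ₈C record's world to the bundle-swapped parameters is again a ₈C record over the SAME datum** (datum, construction, γ-window, `L` are blind
to `W`; the up-clause holds by construction). [cite: Balaban1989LargeFieldII, Thm 1 p.355 (bookkeeping: the record predicate)] -/
theorem isRecordOfRecord₈C_updW (h : IsRecordOfRecord₈C F N D w) :
    ∃ θ : Stage8Params F N, θ.Admissible ∧ (∀ P, w.up P = upOfRecord₅C F N (θ.toStage5 F N) P) ∧
      ∀ W' : B12.RunParams → PrintedCarriers15,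
        IsRecordOfRecord₈C F N D
          { w with up := fun P => upOfRecord₅C F N (({ θ with res := { θ.res with W := W' } } : Stage8Params F N).toStage5 F N) P } := by
  obtain ⟨θ, hθ, hD, hC, hγ, hL, hup⟩ := h
  refine ⟨θ, hθ, hup, fun W' => ⟨{ θ with res := { θ.res with W := W' } }, admissible₈_updW hθ W', ?_, hC, hγ, hL, fun _ => rfl⟩⟩
  rw [toStage5_updW₈, datumOfRecord₅_updW]
  exact hD

/-- **Re-binding a ₅C record's world to the bundle-swapped parameters is again a ₅C record over the SAME datum.** [cite: Balaban1989LargeFieldII, Thm 1 p.355 (bookkeeping)] -/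
theorem isRecordOfRecord₅C_updW (h : IsRecordOfRecord₅C F N D w) :
    ∃ θ : Stage5Params F N, θ.Admissible ∧ (∀ P, w.up P = upOfRecord₅C F N θ P) ∧
      ∀ W' : B12.RunParams → PrintedCarriers15,
        IsRecordOfRecord₅C F N D { w with up := fun P => upOfRecord₅C F N { θ with res := { θ.res with W := W' } } P } := by
  obtain ⟨θ, hθ, hD, hC, hγ, hL, hup⟩ := h
  refine ⟨θ, hθ, hup, fun W' => ⟨{ θ with res := { θ.res with W := W' } }, hθ, ?_, hC, hγ, hL, fun _ => rfl⟩⟩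
  rw [datumOfRecord₅_updW]
  exact hD

/-- A four-torus family (block size `L = 13`, torus exponent `m = 1`) — only to instantiate the family quantifier of `AtRecord` in the census below.
[cite: Balaban1987RG1, (0.1) p.251 («L is an odd, positive integer > 11»; bookkeeping witness)] -/
private theorem exists_family : ∃ _F : T4Family, True :=
  ⟨⟨13, ⟨⟨6, by norm_num⟩, by norm_num⟩, by norm_num, 1, le_rfl⟩, trivial⟩

/-- **CENSUS, ₈C — UNCONDITIONAL**: the LEAF FORM of N12's slot over NODE 00's Stage-8 record predicate of record is FALSE: `¬ AtRecord ₈C (·.rBasicStep)`.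
Witness: a ₈C record exists on the `L = 13` family (`Record8Inhabited.exists_isRecordOfRecord₈C`, the zero-chart typing witness); re-bind its world to the
bundle with an empty (1.89) claim (`isRecordOfRecord₈C_updW`); that record's `rBasicStep` leaf fails (`not_b15Leaf_emptyClaim`).  F-n24T-1 ∕ (R-C1) class, A2.
[cite: Balaban1989LargeFieldI, Prop. 1 p.194, (1.89) p.198 (as the leaf types it); Balaban1989LargeFieldII, Thm 1 p.355 (bookkeeping census)] -/
theorem not_atRecord_rBasicStep₈C :
    ¬ AtRecord (N := N) (fun F D w => IsRecordOfRecord₈C F N D w) fun ℓ => ℓ.rBasicStep := by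
  intro hall
  obtain ⟨F, -⟩ := exists_family
  obtain ⟨D, w, h⟩ := Node00.Record8Inhabited.exists_isRecordOfRecord₈C F N
  obtain ⟨θ, -, -, hrec⟩ := isRecordOfRecord₈C_updW h
  exact not_b15Leaf_emptyClaim (θ.res.W ⟨0, F.m, 1⟩)
    (hall F D _ (hrec fun P => { θ.res.W P with Cfg := Unit, remaining := fun _ => True, dropped := fun _ => False }) ⟨0, F.m, 1⟩)

/-- **CENSUS, ₇C — UNCONDITIONAL**: `¬ AtRecord ₇C (·.rBasicStep)` (a ₈C record is a ₇C record; seat's module 7 `isRecordOfRecord₇C_updW`).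
[cite: Balaban1989LargeFieldI, Prop. 1 p.194 (bookkeeping census)] -/
theorem not_atRecord_rBasicStep₇C :
    ¬ AtRecord (N := N) (fun F D w => IsRecordOfRecord₇C F N D w) fun ℓ => ℓ.rBasicStep := by
  intro hall
  obtain ⟨F, -⟩ := exists_family
  obtain ⟨D, w, h⟩ := Node00.Record8Inhabited.exists_isRecordOfRecord₈C F N
  obtain ⟨θ, -, -, -, hrec⟩ := isRecordOfRecord₇C_updW (isRecordOfRecord₇C_of_isRecordOfRecord₈C h)
  exact not_b15Leaf_emptyClaim (θ.res.W ⟨0, F.m, 1⟩)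
    (hall F D _ (hrec fun P => { θ.res.W P with Cfg := Unit, remaining := fun _ => True, dropped := fun _ => False }) ⟨0, F.m, 1⟩)

/-- **CENSUS, ₅C (the record predicate of record) — UNCONDITIONAL**: `¬ AtRecord ₅C (·.rBasicStep)`. [cite: Balaban1989LargeFieldI, Prop. 1 p.194 (bookkeeping census)] -/
theorem not_atRecord_rBasicStep₅C :
    ¬ AtRecord (N := N) (fun F D w => IsRecordOfRecord₅C F N D w) fun ℓ => ℓ.rBasicStep := by
  intro hall
  obtain ⟨F, -⟩ := exists_family
  obtain ⟨D, w, h⟩ := Node00.Record8Inhabited.exists_isRecordOfRecord₈C F N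
  obtain ⟨θ, -, -, hrec⟩ := isRecordOfRecord₅C_updW (isRecordOfRecord₅C_of_isRecordOfRecord₈C h)
  exact not_b15Leaf_emptyClaim (θ.res.W ⟨0, F.m, 1⟩)
    (hall F D _ (hrec fun P => { θ.res.W P with Cfg := Unit, remaining := fun _ => True, dropped := fun _ => False }) ⟨0, F.m, 1⟩)

/-- Consequently no closer of `S_N12` «from the leaf» can exist over ₈C: the hypothesis of `s_N12_of_leaf` at `Rec := ₈C` is FALSE (and likewise ₇C, ₅C).
[cite: Balaban1989LargeFieldI, Prop. 1 p.194 (bookkeeping census)] -/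
theorem not_leafHypothesis₈C :
    ¬ ∀ (F : T4Family) (D : Datum F N) (w : WorldP), IsRecordOfRecord₈C F N D w → ∀ P : B12.RunParams, (leavesP w P).rBasicStep :=
  not_atRecord_rBasicStep₈C

end Census

/-! ## §4 THE CONDITIONAL CLOSERS OF RECORD: refinement-generic, for NODE 00's W-pinning refinement (Stage ₉) -/

section Closers

/-- **REFINEMENT-GENERIC CONDITIONAL CLOSER (leaf form).**  For EVERY record predicate `Rec` whose pairs are, family by family, bound to `upOfRecord₅C (toS5 θ)`
for SOME admissible parameter `θ` of a refinement `Θ F` of NODE 00's Stage-5 parameters (the shape of `IsRecordOfRecord₅C ∕ ₇C ∕ ₈C ∕ ₉C`) AT WHOSE `res.W` THE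
B15 LEAF HOLDS for every admissible `θ` and run: `S_N12 Rec` (seat's `B15LeafKnitRecord7.b15_main_of_refines₅C_of_leaf` under `AtRecord`).  At ₅C ∕ ₇C ∕ ₈C the
leaf hypothesis is unsatisfiable (§3: `res.W` residual); at a refinement PINNING `res.W` it is [IV]'s content at the objects of record.
[cite: Balaban1989LargeFieldI, Prop. 1 (1.78) p.194, (0.4)–(0.6) p.176, (1.80) p.195, (1.89) p.198, (1.102) p.201 (the leaf at the objects of record; bookkeeping hook)] -/
theorem s_N12_of_refines₅C_of_leaf (Rec : RecordPred N) {Θ : T4Family → Type*}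
    (toS5 : ∀ F, Θ F → Stage5Params F N) (Adm : ∀ F, Θ F → Prop)
    (hR : ∀ (F : T4Family) (D : Datum F N) (w : WorldP), Rec F D w → ∃ θ : Θ F, Adm F θ ∧ ∀ P, w.up P = upOfRecord₅C F N (toS5 F θ) P)
    (hleaf : ∀ (F : T4Family) (θ : Θ F), Adm F θ → ∀ P : B12.RunParams, B15Leaf ((toS5 F θ).res.W P)) : S_N12 Rec :=
  fun F D w hRec P => b15_main_of_refines₅C_of_leaf (toS5 F) (Adm F) (hleaf F) (hR F D w hRec) P

/-- **THE CONDITIONAL CLOSER OF RECORD AT THE REPRESENTED TOWER (Stage ₉).**  For EVERY `Rec` whose pairs are bound, family by family, to `upOfRecord₅C (toS5 θ)`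
for some admissible `θ : Θ F` whose Stage-5 view PINS the [IV] bundle of every run to the bundle READ AT THE PRE-𝐑 REPRESENTATION `Tstep rep_k` OF THE
TOWER OF RECORD — `(toS5 F θ).res.W P = WOfRepr (repTOfRecord9 F N (ν θ) (τ θ) (E θ) (sw θ) (sel θ) P (g θ P) (k θ P)) (sel θ P (g θ P) (k θ P + 1))
(fibOfSeq F (ν θ) (τ θ) P (g θ P) (k θ P + 1)) (LF θ P) (D189 θ P) (D1100 θ P)` (seat node00-def-T's `RepTowerOfRecord`; seat node00-def-R's selector and fibre
bonds; the step `k θ P` the binding reads) —: `S_N12 Rec` from, per admissible `θ` and run, the pre-𝐑 terms `χ_{k+1}(s)·(𝐓e^A)_{k+1}(s)` measurable ∕ ≥ 0 ∕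
bounded ∕ of POSITIVE MASS (p.176 ll.14–16 in the chair's (R-C2) MASS reading) and EXACTLY the displayed printed statements Proposition 1 (1.78) on `LF θ P`,
(1.80) on the ℍ-domains of `D189 θ P`, (1.89), (1.102) for `D1100 θ P` at `𝐓ρ_k` of record (seat's `B15LeafKnitTower9.b15_main_of_refines₅C_WOfTower9` under
`AtRecord`).  THE closer the rev-1 `closes` over NODE 00's W-pinned Stage-₉ record predicate consumes by ONE application to its refinement lemma.
[cite: Balaban1989LargeFieldI, Prop. 1 (1.78) p.194, (0.2)–(0.6) p.176, (1.80) p.195, (1.89) p.198, (1.102) p.201; Balaban1988Convergent, (2.18) p.257, (3.25) p.270] -/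
theorem s_N12_of_refines₅C_WOfTower9 (Rec : RecordPred N) {Θ : T4Family → Type*}
    (toS5 : ∀ F, Θ F → Stage5Params F N) (Adm : ∀ F, Θ F → Prop)
    (ν : ∀ F, Θ F → Stage7Numerics) (τ : ∀ F, Θ F → TowerNumerics) (E : ∀ F, Θ F → B12.RunParams → ℝ)
    (sw : ∀ F (θ : Θ F), StepWeightsOfRecord F N (ν F θ) (τ F θ).M) (sel : ∀ F (θ : Θ F), PpSelOfRecord F (ν F θ) (τ F θ).M)
    (g : ∀ F, Θ F → B12.RunParams → ℕ → ℝ) (k : ∀ F, Θ F → B12.RunParams → ℕ)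
    [∀ F (θ : Θ F) (Pr : B12.RunParams), DecidableEq (PBond (F.P Pr.K) (k F θ Pr + 1))]
    {P₀ : ∀ F, Θ F → B12.RunParams → Params} {Cfg ι : ∀ F, Θ F → B12.RunParams → Type}
    (LF : ∀ F, Θ F → B12.RunParams → B15.LFVar)
    (D189 : ∀ F (θ : Θ F) (Pr : B12.RunParams), B15Claim189Assembly.Setting189 (P₀ F θ Pr) (YMDAG.UVSplit.SU N) (Cfg F θ Pr) (ι F θ Pr))
    (D1100 : ∀ F (θ : Θ F) (Pr : B12.RunParams), B15Sect1Statements.RPrimeData (F.P Pr.K) (k F θ Pr + 1) (YMDAG.UVSplit.SU N))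
    (hR : ∀ (F : T4Family) (D : Datum F N) (w : WorldP), Rec F D w → ∃ θ : Θ F, Adm F θ ∧ ∀ P, w.up P = upOfRecord₅C F N (toS5 F θ) P)
    (hpin : ∀ F (θ : Θ F), Adm F θ → ∀ Pr : B12.RunParams,
      (toS5 F θ).res.W Pr = WOfRepr (repTOfRecord9 F N (ν F θ) (τ F θ) (E F θ) (sw F θ) (sel F θ) Pr (g F θ Pr) (k F θ Pr))
        (sel F θ Pr (g F θ Pr) (k F θ Pr + 1)) (fibOfSeq F (ν F θ) (τ F θ) Pr (g F θ Pr) (k F θ Pr + 1))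
        (LF F θ Pr) (D189 F θ Pr) (D1100 F θ Pr))
    (hm : ∀ F (θ : Θ F), Adm F θ → ∀ (Pr : B12.RunParams) s,
      Measurable (rterm (repTOfRecord9 F N (ν F θ) (τ F θ) (E F θ) (sw F θ) (sel F θ) Pr (g F θ Pr) (k F θ Pr)) s))
    (h0 : ∀ F (θ : Θ F), Adm F θ → ∀ (Pr : B12.RunParams) s V,
      0 ≤ rterm (repTOfRecord9 F N (ν F θ) (τ F θ) (E F θ) (sw F θ) (sel F θ) Pr (g F θ Pr) (k F θ Pr)) s V)
    (hC : ∀ F (θ : Θ F), Adm F θ → ∀ Pr : B12.RunParams, ∃ Cρ : ℝ, ∀ s V,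
      rterm (repTOfRecord9 F N (ν F θ) (τ F θ) (E F θ) (sw F θ) (sel F θ) Pr (g F θ Pr) (k F θ Pr)) s V ≤ Cρ)
    (hmass : ∀ F (θ : Θ F), Adm F θ → ∀ (Pr : B12.RunParams) s,
      0 < ∫ V, rterm (repTOfRecord9 F N (ν F θ) (τ F θ) (E F θ) (sw F θ) (sel F θ) Pr (g F θ Pr) (k F θ Pr)) s V
        ∂(fieldMeasure (F.P Pr.K) (k F θ Pr + 1) (YMDAG.UVSplit.SU N)))
    (hP1 : ∀ F (θ : Θ F), Adm F θ → ∀ Pr : B12.RunParams, B15.Prop1Printed (LF F θ Pr))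
    (h180 : ∀ F (θ : Θ F), Adm F θ → ∀ (Pr : B12.RunParams) U, B15Claim189Assembly.new189 (D189 F θ Pr) U →
      ∀ i, (D189 F θ Pr).h ≤ i → i ≤ (D189 F θ Pr).k → ∀ q ∈ B8Eq17ClassAkV1.plaqsOf (B15Claim189Assembly.dom (D189 F θ Pr) i),
      B15.Ineq180 ((D189 F θ Pr).dev0 U q) ((D189 F θ Pr).ε (D189 F θ Pr).k) (D189 F θ Pr).η (D189 F θ Pr).B₃ (D189 F θ Pr).B₅ (D189 F θ Pr).M
        (D189 F θ Pr).δ ((D189 F θ Pr).dist q) (D189 F θ Pr).O1)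
    (h189 : ∀ F (θ : Θ F), Adm F θ → ∀ Pr : B12.RunParams,
      B15.BasicStep.Claim189 (B15Claim189Assembly.new189 (D189 F θ Pr)) (B15Claim189Assembly.chiPP (D189 F θ Pr)))
    (h1102 : ∀ F (θ : Θ F), Adm F θ → ∀ Pr : B12.RunParams,
      B15Sect1Statements.Normalization1102 (D1100 F θ Pr) (trhoOfRecord9 F N (ν F θ) (τ F θ) (E F θ) (sw F θ) (sel F θ) Pr (g F θ Pr) (k F θ Pr))) :
    S_N12 Rec :=
  fun F D w hRec Pr => b15_main_of_refines₅C_WOfTower9 (toS5 F) (Adm F) (ν F) (τ F) (E F) (sw F) (sel F) (g F) (k F) (LF F) (D189 F) (D1100 F)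
    (hpin F) (hm F) (h0 F) (hC F) (hmass F) (hP1 F) (h180 F) (h189 F) (h1102 F) (hR F D w hRec) Pr

end Closers

/-! ## §5 K3 bookkeeping: `RenormalisationBeta Rec` from the other stubs and N12's conditional closer's hypotheses -/

/-- **The K3 cluster from its stubs with N12 read in leaf form** — given the other K3 stubs (N05, N07, N08; END; β-side) at a `Rec` refining ₅C, and N12's [IV]
leaf at every record run (what NODE 00's W-pinning refinement + [IV]'s estimates deliver through §4), `RenormalisationBeta Rec`
(`BalabanUVNodesN04AtRecord.renormalisationBeta_of_rest_of_refines₅C`, N04 of record supplied there). [cite: Balaban1989LargeFieldI, Prop. 1 p.194; Balaban1989LargeFieldII, Thm 1 p.355 (cluster bookkeeping)] -/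
theorem renormalisationBeta_of_rest_of_refines₅C_of_leaf (Rec : RecordPred N)
    (hR : ∀ (F : T4Family) (D : Datum F N) (w : WorldP), Rec F D w → IsRecordOfRecord₅C F N D w)
    (h05 : S_N05 Rec) (h07 : S_N07 Rec) (h08 : S_N08 Rec) (h25 : S_N25 Rec) (hβ : S_BetaSide Rec)
    (hleaf : ∀ (F : T4Family) (D : Datum F N) (w : WorldP), Rec F D w → ∀ P : B12.RunParams, (leavesP w P).rBasicStep) :
    RenormalisationBeta Rec :=
  renormalisationBeta_of_rest_of_refines₅C Rec hR h05 h07 h08 (s_N12_of_leaf Rec hleaf) h25 hβ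

end Summit.QuantumFields.YangMills.BalabanUVNodes.N12AtRecord

end
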